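import Summits.QuantumFields.YangMills.Theorems.BalabanUVNodesK0AllTorusOfStepTokensGuardedZBLamPrint

/-!
# (POST-SEAM ONLY — NOT FILEABLE BEFORE def-R's Stage-2 seam edit of `Node00/Record13CoP.lean` :164–167 lands) K0⁷'s V23 body with `hseam` DISCHARGED

Cell `pub-ymgap`, seat `pub-ymgap-k0-s1-w1` g9 — STAGED TEXT for the successor ∕ plan seat.  After the seam edit, `UbgOfRecord₁₃CoP_succ` reads
`UbgOfRecord₁₃CoP F N θ p (n+1) = UbgMSCoPOfRecordB F N θ.ν θ.τ9.M (gOfRecord₁₃ F N θ p) p.K (n+1)` (def-R S2-DESIGN-1: NAME kept, still `rfl`), so `hseam_holds` below is `rfl`∕that lemma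
pointwise, and the K0⁷ body over print's datum + print's (7) is hypothesis-free but for the three stub texts.  BEFORE the seam edit this file does NOT elaborate (the (b) background is not
the Λ-minimiser) — do not file it early.  `--kind proof --supports stmt-QuantumFields-20541 --as helper`.
HONEST: bookkeeping; conditional on CANDIDATE V23 texts until registered; K0⁷ NOT closed by this file alone (stub 1ᴮ by name = n07-e's 140′; stub 3ᴮ = N24∕NODE O road); YM mass gap NOT proved.
-/

noncomputable section

open scoped Matrix.Norms.L2Operator

namespace Summit.QuantumFields.YangMills.Theorems.K0AllTorusOfStepTokensGuardedZBLam

open Literature.MathematicalPhysics.QuantumFieldTheory.Balaban1983to89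
open Literature.MathematicalPhysics.QuantumFieldTheory.Balaban1983to89.Node00
open Literature.MathematicalPhysics.QuantumFieldTheory.Balaban1983to89.T4Continuum
open Literature.MathematicalPhysics.QuantumFieldTheory.Balaban1983to89.FlowStep
open Literature.MathematicalPhysics.QuantumFieldTheory.Balaban1983to89.B15DeterminingSets
open Literature.MathematicalPhysics.QuantumFieldTheory.Balaban1983to89.B8LeafModelZd (ZdIdx)

/-- **THE STAGE-2 SEAM, AS A THEOREM** (post-seam: `UbgOfRecord₁₃CoP_succ`). [cite: Balaban1988Convergent, (2.12)–(2.13) p.256–257; Balaban1984PropagatorsII, (2.3) p.224] -/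
theorem hseam_holds (F : T4Family) (N : ℕ) [NeZero N] (θ : Stage13Params F N) (p : B12.RunParams) (n : ℕ)
    (s : SeqOfRecord F θ.ν θ.τ9.M (gOfRecord₁₃ F N θ p) p.K (n + 1)) (W : MSField (F.P p.K) (SU N)) :
    UbgOfRecord₁₃CoP F N θ p (n + 1) s W = UbgMSCoPOfRecordB F N θ.ν θ.τ9.M (gOfRecord₁₃ F N θ p) p.K (n + 1) s W := by
  rw [UbgOfRecord₁₃CoP_succ]   -- if the seam keeps `_succ` as `rfl`, `rfl` also closes this

variable {Efl logz : B12.RunParams → ℕ → ℝ}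

/-- **★★★ K0⁷'s BODY AT EVERY FAMILY OVER PRINT's DATUM AND PRINT's (7), FROM THE THREE V23-SHAPED TEXTS ALONE.** [cite: Balaban1985Variational, Thm 1 (8)–(9) p.279, Prop. 8 p.304; Balaban1988Convergent, Thm 1 p.262] -/
theorem record13SepCoPHBody_of_stubs1GBPrint_2P_3A'GBPrintZB
    (h1G : ∀ F : T4Family, ∃ (c c₀ c₁ : ℕ) (B₃ a₀ a₁ : ℝ), 2 * (F.L : ℝ) ^ 2 ≤ B₃ ∧ 0 < a₀ ∧ 0 < a₁ ∧
      Prop8RegSepTopStepGB F 2 (fun ν K Ω => suppDomOfRecord F ν K Ω) (fun ν M g K k _s => c ≤ ν.M₁ ∧ k + c₀ ≤ F.m + K ∧ F.L ^ c₁ ∣ M ∧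
      ∀ i, 1 ≤ i → i ≤ k → dCubeSide (F.P K).L M (RkOfRecord (F.P K).L ν.r (g i)) i ∣ (F.P K).sitesPerDir 0) (lamDatum F) (dataSmall7LamTopOf F 2) B₃ a₀ a₁)
    (h2P : ∀ F : T4Family, ∃ (ρ₀ : ℕ) (B₁ c₁ : ℝ), 1 ≤ ρ₀ ∧ 0 ≤ B₁ ∧ 0 < c₁ ∧
      (letI : CStarAlgebra (MatA 2) := {}; B8.Prop6Printed 4 (F.L : ℝ) B₁ c₁ (fun i : ZdIdx 4 F.L => zdCubP (MatA 2) F.L ρ₀ i)))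
    (h3A'G : ∀ (F : T4Family) (j c c₀ c₁ : ℕ) (B₃ B₃' a₀ a₁ : ℝ), c ≤ F.L ^ j → c₀ ≤ j + 1 → c₁ ≤ j → 2 * (F.L : ℝ) ^ 2 ≤ B₃ → 0 < B₃' → 0 < a₀ → 0 < a₁ →
      VariationalThm1RegSepCoP7MGB F 2 (fun ν M g K k _s => c ≤ ν.M₁ ∧ k + c₀ ≤ F.m + K ∧ F.L ^ c₁ ∣ M ∧
      ∀ i, 1 ≤ i → i ≤ k → dCubeSide (F.P K).L M (RkOfRecord (F.P K).L ν.r (g i)) i ∣ (F.P K).sitesPerDir 0) (lamDatum F) (dataSmall7LamTopOf F 2) B₃ a₀ a₁ →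
      Gauge9RegSepTopStepGB F 2 (fun ν K Ω => suppDomOfRecord F ν K Ω) (F.L ^ j) (fun ν M g K k _s => c ≤ ν.M₁ ∧ k + c₀ ≤ F.m + K ∧ F.L ^ c₁ ∣ M ∧
      ∀ i, 1 ≤ i → i ≤ k → dCubeSide (F.P K).L M (RkOfRecord (F.P K).L ν.r (g i)) i ∣ (F.P K).sitesPerDir 0) (lamDatum F) (dataSmall7LamTopOf F 2) B₃ B₃' a₀ a₁ →
      ∃ γ₀ ε₀ ε₂₉ β' : ℝ, 0 < γ₀ ∧ 0 < ε₀ ∧ 0 < ε₂₉ ∧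
        BetaLowerH (-β') γ₀ (betaOfRecord₁₃ F 2 (theta13OfThm1CCMWZB F 2 j (1 / 2) a₀ ε₀ ε₂₉ B₃ B₃' a₀ a₁ Efl logz)) ∧
        BetaUpperH β' γ₀ (betaOfRecord₁₃ F 2 (theta13OfThm1CCMWZB F 2 j (1 / 2) a₀ ε₀ ε₂₉ B₃ B₃' a₀ a₁ Efl logz))) :
    ∀ F : T4Family, ∃ θ : Stage13HParams F 2, θ.Provisos₁₃SepCoPH F 2 ∧ (θ.ZhUnity F 2 ∧ θ.SlotsNondegenerate₁₃ F 2) ∧ θ.Admissible F 2 :=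
  record13SepCoPHBody_of_stubs1GBPrint_2P_3A'GBPrintZB_lam (fun F θ p n s W => hseam_holds F 2 θ p n s W) h1G h2P h3A'G

end Summit.QuantumFields.YangMills.Theorems.K0AllTorusOfStepTokensGuardedZBLam

end
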